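import Summits.CriticalPhenomena.CardyFormulaZ2.Theorems.CardyMeckeFlipMeckeRigidityDilationAPI

/-!
# The RSW lower bound transports under dilations

Route `Summits/CriticalPhenomena/CardyFormulaZ2/Theses/CardyMeckeFlip`, crux `MeckeRigidity`
(item stmt-CriticalPhenomena-14826), line `registered`, stub `rsw_map_dilate`.

If a law `P` on `ℋ_ℂ` crosses every axis-parallel `3 : 1` rectangle `[x, x + 3a] × [y, y + a]`
(left edge to right edge) with probability at least `c > 0`, then so does `(S_t)_* P` for every
`t > 0`, with the same constant: `(S_t)_* P (⊞_Q) = P (⊞_{S_{t⁻¹} Q})`, and `S_{t⁻¹}` maps the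
rectangle with data `(a, x, y)` (carrier and left/right edges) onto the one with data
`(a / t, x / t, y / t)`.
-/

noncomputable section

open MeasureTheory Set Metric Filter Topology
open Literature.Probability.Percolation Literature.Probability.Percolation.QuadCrossing

namespace Summit.CriticalPhenomena.CardyFormulaZ2.Theorems.CardyMeckeFlip

/-- `t⁻¹ · (t · w) = w` for a nonzero real `t` (real casts). [folklore] -/
private theorem ofReal_inv_mul_ofReal_mul {t : ℝ} (ht : t ≠ 0) (w : ℂ) :
    ((t⁻¹ : ℝ) : ℂ) * ((t : ℂ) * w) = w := by
  rw [← mul_assoc, ← Complex.ofReal_mul, inv_mul_cancel₀ ht, Complex.ofReal_one, one_mul]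

/-- The image of the rectangle `[x, x + 3a] × [y, y + a]` under `w ↦ t⁻¹ w` (`t > 0`) is the
rectangle `[x/t, x/t + 3(a/t)] × [y/t, y/t + a/t]`. [folklore] -/
private theorem image_inv_mul_rectangle {t : ℝ} (ht : 0 < t) (a x y : ℝ) :
    (fun w : ℂ => ((t⁻¹ : ℝ) : ℂ) * w) ''
        {w : ℂ | x ≤ w.re ∧ w.re ≤ x + 3 * a ∧ y ≤ w.im ∧ w.im ≤ y + a} =
      {w : ℂ | x / t ≤ w.re ∧ w.re ≤ x / t + 3 * (a / t) ∧ y / t ≤ w.im ∧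
        w.im ≤ y / t + a / t} := by
  have h3 : x / t + 3 * (a / t) = t⁻¹ * (x + 3 * a) := by ring
  have h1 : y / t + a / t = t⁻¹ * (y + a) := by ring
  have ht₀ : (0 : ℝ) ≤ t⁻¹ := inv_nonneg.mpr ht.le
  ext w
  simp only [mem_image, mem_setOf_eq]
  constructor
  · rintro ⟨v, ⟨hv1, hv2, hv3, hv4⟩, rfl⟩
    rw [Complex.re_ofReal_mul, Complex.im_ofReal_mul, h3, h1, div_eq_inv_mul, div_eq_inv_mul]
    exact ⟨mul_le_mul_of_nonneg_left hv1 ht₀, mul_le_mul_of_nonneg_left hv2 ht₀,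
      mul_le_mul_of_nonneg_left hv3 ht₀, mul_le_mul_of_nonneg_left hv4 ht₀⟩
  · rintro ⟨hw1, hw2, hw3, hw4⟩
    refine ⟨(t : ℂ) * w, ?_, ofReal_inv_mul_ofReal_mul ht.ne' w⟩
    rw [Complex.re_ofReal_mul, Complex.im_ofReal_mul]
    rw [h3, ← div_eq_inv_mul, le_div_iff₀ ht] at hw2
    rw [h1, ← div_eq_inv_mul, le_div_iff₀ ht] at hw4
    rw [div_le_iff₀ ht] at hw1 hw3
    exact ⟨by linarith, by linarith, by linarith, by linarith⟩

/-- The image of the vertical segment `{x₀} × [y, y + a]` under `w ↦ t⁻¹ w` (`t > 0`) is the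
segment `{x₀/t} × [y/t, y/t + a/t]`. [folklore] -/
private theorem image_inv_mul_vsegment {t : ℝ} (ht : 0 < t) (a x₀ y : ℝ) :
    (fun w : ℂ => ((t⁻¹ : ℝ) : ℂ) * w) '' {w : ℂ | w.re = x₀ ∧ y ≤ w.im ∧ w.im ≤ y + a} =
      {w : ℂ | w.re = x₀ / t ∧ y / t ≤ w.im ∧ w.im ≤ y / t + a / t} := by
  have h1 : y / t + a / t = t⁻¹ * (y + a) := by ring
  have ht₀ : (0 : ℝ) ≤ t⁻¹ := inv_nonneg.mpr ht.le
  ext w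
  simp only [mem_image, mem_setOf_eq]
  constructor
  · rintro ⟨v, ⟨hv1, hv2, hv3⟩, rfl⟩
    rw [Complex.re_ofReal_mul, Complex.im_ofReal_mul, h1, hv1, div_eq_inv_mul, div_eq_inv_mul]
    exact ⟨rfl, mul_le_mul_of_nonneg_left hv2 ht₀, mul_le_mul_of_nonneg_left hv3 ht₀⟩
  · rintro ⟨hw1, hw2, hw3⟩
    refine ⟨(t : ℂ) * w, ?_, ofReal_inv_mul_ofReal_mul ht.ne' w⟩
    rw [Complex.re_ofReal_mul, Complex.im_ofReal_mul, hw1, mul_div_cancel₀ _ ht.ne']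
    rw [h1, ← div_eq_inv_mul, le_div_iff₀ ht] at hw3
    rw [div_le_iff₀ ht] at hw2
    exact ⟨rfl, by linarith, by linarith⟩

/-- **(RSW) transports under dilations.** If `P` crosses every axis-parallel `3 : 1` rectangle
`[x, x + 3a] × [y, y + a]` from its left edge to its right edge with probability `≥ c > 0`, then so
does `(S_t)_* P` (`t > 0`), with the same constant: `(S_t)_* P (⊞_Q) = P (⊞_{S_{t⁻¹} Q})` and
`S_{t⁻¹} Q` is the rectangle quad with data `(a / t, x / t, y / t)`. [folklore] -/
theorem rsw_map_dilate : ∀ (P : Measure (QuadConfig (Set.univ : Set ℂ))) (t : ℝ) (ht : 0 < t), (∃ c : ℝ, 0 < c ∧ ∀ (a x y : ℝ), 0 < a → ∀ Q : Quad (Set.univ : Set ℂ), Q.carrier = {w : ℂ | x ≤ w.re ∧ w.re ≤ x + 3 * a ∧ y ≤ w.im ∧ w.im ≤ y + a} → Q.side 0 = {w : ℂ | w.re = x ∧ y ≤ w.im ∧ w.im ≤ y + a} → Q.side 2 = {w : ℂ | w.re = x + 3 * a ∧ y ≤ w.im ∧ w.im ≤ y + a} → c ≤ P.real (QuadConfig.crossedEvent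 Q)) → ∃ c : ℝ, 0 < c ∧ ∀ (a x y : ℝ), 0 < a → ∀ Q : Quad (Set.univ : Set ℂ), Q.carrier = {w : ℂ | x ≤ w.re ∧ w.re ≤ x + 3 * a ∧ y ≤ w.im ∧ w.im ≤ y + a} → Q.side 0 = {w : ℂ | w.re = x ∧ y ≤ w.im ∧ w.im ≤ y + a} → Q.side 2 = {w : ℂ | w.re = x + 3 * a ∧ y ≤ w.im ∧ w.im ≤ y + a} → c ≤ (Measure.map (QuadConfig.dilate t ht.ne') P).real (QuadConfig.crossedEvent Q) := by
  rintro P t ht ⟨c, hc, h⟩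
  refine ⟨c, hc, fun a x y ha Q hQc hQ0 hQ2 => ?_⟩
  rw [map_dilate_real_crossedEvent]
  refine h (a / t) (x / t) (y / t) (div_pos ha ht) (Q.dilate t⁻¹ (inv_ne_zero ht.ne')) ?_ ?_ ?_
  · rw [carrier_quad_dilate, hQc, image_inv_mul_rectangle ht]
  · rw [side_quad_dilate, hQ0, image_inv_mul_vsegment ht]
  · rw [side_quad_dilate, hQ2, image_inv_mul_vsegment ht, add_div, mul_div_assoc]

end Summit.CriticalPhenomena.CardyFormulaZ2.Theorems.CardyMeckeFlip

end
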